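import Summits.QuantumFields.YangMills.Theorems.BalabanUVNodesN12NearFlatFederbushFibreWindow
import Summits.QuantumFields.YangMills.Theorems.BalabanUVNodesN12NearFlatDelta2LetterComponent

/-!
# BalabanUVNodes ∕ N12 — THE FEDERBUSH LETTER AT THE VELOCITY (`hmX`) AGAINST THE WINDOW FORM: for the (K′) minimiser family at the curved chart of record,
# `γ₀·[(1−η)·(circ X − 16(d+1)τ‖X‖²) − (η⁻¹−1)·8d·|S_k|·(C·δ_W·p(X_f′X))²] ≤ B_W(X_f′X, X_f′X)` — no flat linearisation `L♭`, no right inverse, no fibre: the direct road's producer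

Cell `pub-ymgap` (HUMAN RULINGS D-0062 ∕ D-0149), width seat `pub-ymgap-dag-n12-w4` g5.  The lane owner's DIRECT road (dag-n12-c g20, `HOME/pub-ymgap-dag-n12-c/N12-DIRECT-ROAD-MEMO.md` §1–§3,
2026-08-28): «if instead the Federbush letter is asked AT THE VELOCITY — `hmX : γ₀·circ X − τ‖X‖² ≤ B_W(X_f′X, X_f′X)` — then `L♭`, `R♭`, `q`, `ρ`, `δ₂`, (δ₂) all disappear … `hmX` (to be
typed, M, w4's Federbush lineage): flat local Federbush for an ARBITRARY fine field … at `w′ := X_f′X`; then on the window's level-k bonds `Q♭_k(X_f′X) = Q_{U₀,k}(X_f′X) − E` ((β3) + twist (T)),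
`‖E‖ ≤ C·δ_W·Kc‖X‖` on the WINDOW TOWERS ONLY, and `circ(a+e) ≥ (1−η)circ(a) − η⁻¹circ(e)`».  Key K1⁹ `stmt-QuantumFields-27364`, `--kind proof --supports … --as helper`; count-neutral;
THEOREMS ONLY (0 `def`, 0 `sorry`, 0 `instance`).  CONSUMED BY NAME: this seat's `B16Ineq17FlatRouteConstants.sum_normSq_oc_top_le_weighted_of_flat_chain` (v1.1: the weighted chain for an
ARBITRARY chain, weight `𝟙_{S_0}`), `…N12NearFlatDelta2LetterComponent.exists_delta2_letter_component_Bj` ((δ₂) per component on ONE tower), `…N12NearFlatFederbushFibreTwisted.exists_rotE3_of_lieSU2Coord`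
∕ `exists_twistSlice` ∕ `twistSlice_close` (p611770), `B16Ineq17NearFlatDatumFamily.fderiv_msChart_comp_apply_top_of_isMinimizer_family` ((β3), p608042), `B16Ineq17SliceTwist.circ_twist_ge_sub` ((T),
p605427), `…FibreChart.iterLin_eq_of_fderiv_msChart_one_eq` (p603788), `…FibreRecord.hcons_of_plaqsInside_maxDomT` (p604917), `…Fibre.exists_su2ReCoord` ∕ `lieSU2Coord_reCoord_eq` (p602396),
`B16Ineq17NearFlatWilsonLettersWindow.flatFormOn_apply_self` (p645091), g0's `circ_eq_sum_normSq_oc` ∕ `sum_box_castSite_le_sum_of_subset` ∕ `oc_self_eq_zero`, dag-n10-w1's `chainLaw_iterLin_comp_linearMap`,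
dag-n12-w3's `norm_sq_lieSU2Coord`.

THE PRINT.  [Balaban1989LargeFieldII] p. 357 foot – p. 358 (1.7) («the leading term … with the background field identically equal to 1 … Using the bound (1.67) [10] for this form, we
obtain (1.7)», read on the window `B^k(Λ₀)`), (1.12) p. 359, (1.19) p. 360; [Federbush1986PhaseCellI] 'Abelian Stability Theorem' (0.12) p. 321; [Balaban1988Convergent] (2.10)–(2.13)
pp. 256–257; [Balaban1985Variational] (45) p. 285, (82)–(83) p. 290.

READING.  The chain `Y_i := ψ∘Q♭_i(↑X_f′X)` of the FLAT linearised averages of the velocity obeys g0's `oc`-chain law exactly (linearity), so the weighted chain with `ζ := 𝟙_{S_0}` bounds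
`γ₀·Σ_{ν≠e₀}Σ_{y∈S_k}‖oc(Y_k) e₀ ν y‖²` by `B_W(X_f′X, X_f′X)` for every `W ⊇ {q | q.src ∈ S_0}`.  On the region's level-`k` constrained bonds `b`, `Q♭_k(↑X_f′X)(b) = ↑(DΦ♭(0)X_f′X)_{(k,b)}`
(dag-n10-w1 (J-b) B) and `(DΨ_{U₀}(0)X_f′X)_{(k,b)} = φ(ιA X̃ b)` EXACTLY by (β3) (the family lives on the constraint surface; `X̃` the twisted slice vector), so `Y_k = ιA X̃ − D` with
`D(b) = ψ(↑E_b)`, `E_b := (DΨ_{U₀}(0) − DΦ♭(0))(X_f′X)_{(k,b)}`, `‖D(b)‖² = ‖E_b‖²∕2 ≤ (C·δ_W·p(X_f′X))²∕2` by the (δ₂) COMPONENT letter — near-flatness of `U₀` asked on the WINDOW TOWERS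
`feeds k b` ONLY.  Then `‖a − e‖² ≥ (1−η)‖a‖² − (η⁻¹−1)‖e‖²` per axial plaquette, g0's Step 1 `circ(X̃) ≤ Σ‖oc(ιA X̃)‖²` and (T) `circ(X̃) ≥ circ(X) − 16(d+1)τ‖X‖²`.

CONTENTS.  §1 `norm_sub_sq_ge'` (the splitting inequality).  §2 ★★★ `exists_hmX_federbush_window_of_isMinimizer_family` — ONE `C ≥ 0`, `ρ > 0` per height (the (δ₂)-component constants) such that,
under p611770 §3's data VERBATIM (region letters `(Q, S_i, hwin, hS, hΩk)`, (K′) family `hmin`, chart differentiability `hΨ`; the twist size `hW′` asked at the REGION's plaquette bonds ONLY) plus a window `W ⊇ {q | q.src ∈ S_0}` of FINE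
plaquettes, tower near-flatness `δ_W < ρ` of `U₀` on `feeds k b` for the four bonds of every `(e₀,e_ν)`-plaquette at the sites of `S_k`, and `0 < η < 1`:
`((L^d)^k∕(L²L²)^k)·[(1−η)·(circ X − 16(d+1)τ‖X‖²) − (η⁻¹−1)·8d·|S_k|·(C·δ_W·p(X_f′X))²] ≤ B_W (X_f′X) (X_f′X)`.  (With (K) `p(X_f′X) ≤ Kc‖X‖` the consumer reads it as
`γ·circ X − Cerr‖X‖² ≤ B_W(X_f′X, X_f′X)`, `γ = γ₀(1−η)`.)  The knit-level tower discharge of the `S_i` is `…FederbushFibreWindowKnit`'s §1 verbatim (not repeated here).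

HONEST FRAMING.  Junction algebra BY NAME over landed kernel theorems; per-height existence constants (`C, ρ` of the (δ₂) row; raw-unit `γ₀`), NOT print's volume-uniform `O(1)`; the window
factor `|S_k|` is per instance; nothing of Bałaban's ((1.7), (1.65)–(1.67), Prop. 1) asserted beyond these kernel inequalities; N12 NOT discharged; K1⁹ NOT closed; count-neutral (typed 28∕28 ·
discharged 5∕27 unmoved); one finite 𝕋⁴ programme at fixed ε — R4 closes the conditional rung `BalabanLadder.UV` only; the YM mass gap (Clay) is NOT proved by any of this.
-/

noncomputable section

open scoped BigOperators Matrix.Norms.L2Operator InnerProductSpace Topology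
open Filter Finset

namespace Summit.QuantumFields.YangMills.BalabanUVNodes.N12NearFlatFederbushVelocityWindow

open Literature.MathematicalPhysics.QuantumFieldTheory.Balaban1983to89
open Literature.MathematicalPhysics.QuantumLattice (quatMatrix)
open T4Continuum (T4Family)
open T4HaarSU2ExpChart (imQuat imQuat_apply norm_imQuat)
open T4QuatExpLog (norm_quatMatrix)
open T4AdjointCovarianceUnitary (lieSU mem_lieSU_iff specialUnitaryAd)
open T4CubeChartGnomonic (SU2)
open B15Prop1ChartSU2 (su2Chart)
open B16Sect1Backgrounds (expMul)
open B15DeterminingSets GaugeField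
open B14.Eq213DetSet (Bj maxDomT)
open B14.Eq216Concrete (feeds)
open B15Prop1SliceCoordinates (GaugeSlice ιA freeBonds ιA_apply_of_mem ιA_apply_of_not_mem)
open T4AxialGaugeSmallField (castSite)
open B6TreeGaugePoincare (curl)
open B16Eq18Proof (box)
open LatticeFieldCalculus (bondAvg runSite)
open B6StairStokesTorus (oc)
open B16Ineq19FlatSliceChart (exists_lieSU2Coord expMul_su2Chart_smul_one_eq_expChart norm_sq_lieSU2Coord)
open B16Ineq17FlatRouteConstants (circ_eq_sum_normSq_oc sum_box_castSite_le_sum_of_subset oc_self_eq_zero)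
open BlockAveragingEMLLinearised (linAvg)
open Literature.MathematicalPhysics.QuantumFieldTheory.BalabanImbrieJaffe1984to88.BIJ85Eq453GaugeField (qsstarGIter0)
open Node00
open B16Ineq17NearFlatWilsonLettersWindow (flatFormOn_apply_self)
open B16Ineq17NearFlatDatumFamily (fderiv_msChart_comp_apply_top_of_isMinimizer_family)
open B16Ineq17SliceTwist (circ_twist_ge_sub)
open Summit.QuantumFields.YangMills.BalabanUVNodes.N12FlatConstraintPlaquetteJunction (chainLaw_iterLin_comp_linearMap)
open Summit.QuantumFields.YangMills.BalabanUVNodes.N12NearFlatFederbushFibre (exists_su2ReCoord lieSU2Coord_reCoord_eq)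
open Summit.QuantumFields.YangMills.BalabanUVNodes.N12NearFlatFederbushFibreChart (iterLin_eq_of_fderiv_msChart_one_eq)
open Summit.QuantumFields.YangMills.BalabanUVNodes.N12NearFlatFederbushFibreRecord (hcons_of_plaqsInside_maxDomT)
open Summit.QuantumFields.YangMills.BalabanUVNodes.N12NearFlatFederbushFibreTwisted (exists_rotE3_of_lieSU2Coord exists_twistSlice twistSlice_close)
open Summit.QuantumFields.YangMills.BalabanUVNodes.N12NearFlatDelta2LetterComponent (exists_delta2_letter_component)

/-! ## §1  Bookkeeping -/

/-- `(1−η)‖a‖² − (η⁻¹−1)‖e‖² ≤ ‖a − e‖²` for `0 < η < 1` (real inner product spaces): the split that keeps a fraction of the leading circulation and pays for the deviation.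
[cite: Balaban1989LargeFieldII, (1.7) p.358 (bookkeeping)] -/
theorem norm_sub_sq_ge' {E : Type*} [NormedAddCommGroup E] [InnerProductSpace ℝ E] (a e : E) {η : ℝ} (hη0 : 0 < η) (hη1 : η < 1) :
    (1 - η) * ‖a‖ ^ 2 - (η⁻¹ - 1) * ‖e‖ ^ 2 ≤ ‖a - e‖ ^ 2 := by
  have hu : ‖a‖ ^ 2 = ‖a - e‖ ^ 2 + 2 * inner ℝ (a - e) e + ‖e‖ ^ 2 := by
    have := norm_add_sq_real (a - e) e
    rw [sub_add_cancel] at this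
    linarith
  have hin : inner ℝ (a - e) e ≤ ‖a - e‖ * ‖e‖ := real_inner_le_norm _ _
  have h2 : 0 ≤ η * (1 - η) := mul_nonneg hη0.le (by linarith)
  have h3 := mul_le_mul_of_nonneg_left hin h2
  have h4 := sq_nonneg (η * ‖a - e‖ - (1 - η) * ‖e‖)
  have key : η * ((1 - η) * ‖a‖ ^ 2) - (1 - η) * ‖e‖ ^ 2 ≤ η * ‖a - e‖ ^ 2 := by
    rw [hu]; nlinarith [h3, h4]
  have hid : (1 - η) * ‖a‖ ^ 2 - (η⁻¹ - 1) * ‖e‖ ^ 2 = η⁻¹ * (η * ((1 - η) * ‖a‖ ^ 2) - (1 - η) * ‖e‖ ^ 2) := by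
    field_simp
  rw [hid]
  calc η⁻¹ * (η * ((1 - η) * ‖a‖ ^ 2) - (1 - η) * ‖e‖ ^ 2) ≤ η⁻¹ * (η * ‖a - e‖ ^ 2) :=
        mul_le_mul_of_nonneg_left key (inv_nonneg.mpr hη0.le)
    _ = ‖a - e‖ ^ 2 := by field_simp


/-! ## §2  The velocity-form Federbush letter against the window form -/

section Velocity

variable {F : T4Family} {K k M₁ : ℕ}

/-- ★★★ **`hmX` — THE FEDERBUSH LETTER AT THE VELOCITY, AGAINST THE WINDOW FORM** (the direct road's producer; see the module docstring for the reading).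
[cite: Balaban1989LargeFieldII, (1.7) pp.357–358, (1.12) p.359, (1.19) p.360; Federbush1986PhaseCellI, 'Abelian Stability Theorem' (0.12) p.321; Balaban1988Convergent, (2.10)–(2.13) pp.256–257; Balaban1985Variational, (45) p.285, (82)–(83) p.290] -/
theorem hmX_federbush_window_of_delta2Component (h0 : 0 < (F.P K).d) (hk : k ≤ (F.P K).m + (F.P K).K)
    (Q : (i : ℕ) → (PBond (F.P K) 0 → Matrix (Fin 2) (Fin 2) ℂ) → PBond (F.P K) i → Matrix (Fin 2) (Fin 2) ℂ)
    (hQ0 : ∀ Y, Q 0 Y = Y) (hQs : ∀ (i : ℕ) (Y : PBond (F.P K) 0 → Matrix (Fin 2) (Fin 2) ℂ) (c : PBond (F.P K) (i + 1)), Q (i + 1) Y c = linAvg (Q i Y) c)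
    (p : Seminorm ℝ (PBond (F.P K) 0 → lieSU (Fin 2)))
    {C ρ : ℝ}
    (hδ2 : ∀ (𝔹 : DetSet (F.P K)) (W : MSField (F.P K) (SU 2)) (U₀ : GaugeField (F.P K) 0 (SU 2)),
      (∀ j, k < j → 𝔹 j = ∅) → k ≤ (F.P K).m + (F.P K).K →
      AgreeOn 𝔹 (avgFamily (avOfRecord F 2 K) U₀) W → DifferentiableAt ℝ (msChart F 2 K k 𝔹 W U₀) 0 →
      ∀ (i : Fin (constrCard 𝔹 k)) ⦃δ : ℝ⦄, 0 ≤ δ → δ < ρ →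
      (∀ b ∈ feeds (((constrEnum 𝔹 k).symm i).1 : ℕ) ((constrEnum 𝔹 k).symm i).2.1, ‖((U₀ b : SU 2) : Matrix (Fin 2) (Fin 2) ℂ) - 1‖ ≤ δ) →
      ∀ w : PBond (F.P K) 0 → lieSU (Fin 2),
        ‖fderiv ℝ (msChart F 2 K k 𝔹 W U₀) 0 w i
            - fderiv ℝ (msChart F 2 K k 𝔹 (avgFamily (avOfRecord F 2 K) (1 : GaugeField (F.P K) 0 (SU 2))) (1 : GaugeField (F.P K) 0 (SU 2))) 0 w i‖
          ≤ C * δ * p w)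
    (Z : Set (Site (F.P K) 0)) {S : Set (Site (F.P K) k)} {T : Finset (PBond (F.P K) k)} (X : GaugeSlice S T (EuclideanSpace ℝ (Fin 3)))
    {m : Fin (F.P K).d → ℕ} (lo : Fin (F.P K).d → ℤ) (hm : ∀ κ, (m κ : ℤ) ≤ (F.P K).sitesPerDir k)
    (Sset : (i : ℕ) → Finset (Site (F.P K) i)) (hwin : ∀ z ∈ box m lo, (castSite z : Site (F.P K) k) ∈ Sset k)
    (hS : ∀ (ν : Fin (F.P K).d), (⟨0, h0⟩ : Fin (F.P K).d) ≠ ν → ∀ i, i < k → ∀ y ∈ Sset (i + 1), ∀ (r : Fin (F.P K).d → Fin (F.P K).L) (s t : ℕ),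
      s < (F.P K).L → t < (F.P K).L → runSite (runSite (Site.blockSite y r) ⟨0, h0⟩ s) ν t ∈ Sset i)
    {φ : EuclideanSpace ℝ (Fin 3) →ₗ[ℝ] lieSU (Fin 2)} (hφ : ∀ v, ((φ v : lieSU (Fin 2)) : Matrix (Fin 2) (Fin 2) ℂ) = quatMatrix (imQuat v))
    (hΩk : ∀ (ν : Fin (F.P K).d), ∀ s ∈ Sset k, s ∈ pts k (maxDomT M₁ Z k) ∧ s.shift ⟨0, h0⟩ ∈ pts k (maxDomT M₁ Z k) ∧ s.shift ν ∈ pts k (maxDomT M₁ Z k))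
    (reg : Set (GaugeField (F.P K) 0 (SU 2))) (V : GaugeField (F.P K) k (SU 2)) (U₀ : GaugeField (F.P K) 0 (SU 2))
    {Xf : GaugeSlice S T (EuclideanSpace ℝ (Fin 3)) → PBond (F.P K) 0 → lieSU (Fin 2)} (hX₀ : Xf 0 = 0)
    (hmin : ∀ᶠ Y in 𝓝 (0 : GaugeSlice S T (EuclideanSpace ℝ (Fin 3))),
      IsMinimizer (avOfRecord F 2 K) reg (Bj M₁ Z k) (avgFamily (avOfRecord F 2 K) (qsstarGIter0 k (expMul su2Chart (ιA S T Y) V))) (expChart U₀ (Xf Y)))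
    {X' : GaugeSlice S T (EuclideanSpace ℝ (Fin 3)) →L[ℝ] PBond (F.P K) 0 → lieSU (Fin 2)} (hX : HasFDerivAt Xf X' 0)
    (hΨ : DifferentiableAt ℝ (msChart F 2 K k (Bj M₁ Z k) (avgFamily (avOfRecord F 2 K) (qsstarGIter0 k V)) U₀) 0)
    {τ : ℝ} (hτ : 0 < τ)
    (hW' : ∀ (ν : Fin (F.P K).d), ∀ s ∈ Sset k,
      ‖((avgFamily (avOfRecord F 2 K) (qsstarGIter0 k V) k ⟨s, ⟨0, h0⟩⟩ : SU 2) : Matrix (Fin 2) (Fin 2) ℂ) - 1‖ ≤ τ / 2 ∧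
      ‖((avgFamily (avOfRecord F 2 K) (qsstarGIter0 k V) k ⟨s.shift ⟨0, h0⟩, ν⟩ : SU 2) : Matrix (Fin 2) (Fin 2) ℂ) - 1‖ ≤ τ / 2 ∧
      ‖((avgFamily (avOfRecord F 2 K) (qsstarGIter0 k V) k ⟨s.shift ν, ⟨0, h0⟩⟩ : SU 2) : Matrix (Fin 2) (Fin 2) ℂ) - 1‖ ≤ τ / 2 ∧
      ‖((avgFamily (avOfRecord F 2 K) (qsstarGIter0 k V) k ⟨s, ν⟩ : SU 2) : Matrix (Fin 2) (Fin 2) ℂ) - 1‖ ≤ τ / 2)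
    (W : Finset (Plaq (F.P K) 0)) (hWin : ∀ q : Plaq (F.P K) 0, q.src ∈ Sset 0 → q ∈ W)
    {δW : ℝ} (hδW0 : 0 ≤ δW) (hδWρ : δW < ρ)
    (hδW : ∀ (ν : Fin (F.P K).d), ∀ s ∈ Sset k, ∀ b₀ : PBond (F.P K) 0,
      (b₀ ∈ feeds k (⟨s, ⟨0, h0⟩⟩ : PBond (F.P K) k) ∨ b₀ ∈ feeds k (⟨s.shift ⟨0, h0⟩, ν⟩ : PBond (F.P K) k)
        ∨ b₀ ∈ feeds k (⟨s.shift ν, ⟨0, h0⟩⟩ : PBond (F.P K) k) ∨ b₀ ∈ feeds k (⟨s, ν⟩ : PBond (F.P K) k)) →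
      ‖((U₀ b₀ : SU 2) : Matrix (Fin 2) (Fin 2) ℂ) - 1‖ ≤ δW)
    {η : ℝ} (hη0 : 0 < η) (hη1 : η < 1) :
    (((F.P K).L : ℝ) ^ (F.P K).d) ^ k / ((((F.P K).L : ℝ)) ^ 2 * ((F.P K).L : ℝ) ^ 2) ^ k *
        ((1 - η) * ((∑ z ∈ box m lo, ∑ μ : Fin (F.P K).d, ∑ a : Fin 3, curl (fun b => ιA S T X (⟨castSite b.1, b.2⟩ : PBond (F.P K) k) a) z ⟨0, h0⟩ μ ^ 2)
            - 16 * (((F.P K).d : ℝ) + 1) * τ * ‖X‖ ^ 2)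
          - (η⁻¹ - 1) * (8 * ((F.P K).d : ℝ) * ((Sset k).card : ℝ) * (C * δW * p (X' X)) ^ 2))
      ≤ ((Fintype.card (Fin 2) : ℝ)⁻¹ • ∑ p ∈ W, (innerSL ℝ (E := lieSU (Fin 2))).bilinearComp
          (ContinuousLinearMap.proj (R := ℝ) (φ := fun _ : PBond (F.P K) 0 => lieSU (Fin 2)) (⟨p.src, p.μ⟩ : PBond (F.P K) 0) + ContinuousLinearMap.proj (R := ℝ) (φ := fun _ : PBond (F.P K) 0 => lieSU (Fin 2)) (⟨p.src.shift p.μ, p.ν⟩ : PBond (F.P K) 0)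
            - ContinuousLinearMap.proj (R := ℝ) (φ := fun _ : PBond (F.P K) 0 => lieSU (Fin 2)) (⟨p.src.shift p.ν, p.μ⟩ : PBond (F.P K) 0) - ContinuousLinearMap.proj (R := ℝ) (φ := fun _ : PBond (F.P K) 0 => lieSU (Fin 2)) (⟨p.src, p.ν⟩ : PBond (F.P K) 0) : (PBond (F.P K) 0 → lieSU (Fin 2)) →L[ℝ] lieSU (Fin 2))
          (ContinuousLinearMap.proj (R := ℝ) (φ := fun _ : PBond (F.P K) 0 => lieSU (Fin 2)) (⟨p.src, p.μ⟩ : PBond (F.P K) 0) + ContinuousLinearMap.proj (R := ℝ) (φ := fun _ : PBond (F.P K) 0 => lieSU (Fin 2)) (⟨p.src.shift p.μ, p.ν⟩ : PBond (F.P K) 0)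
            - ContinuousLinearMap.proj (R := ℝ) (φ := fun _ : PBond (F.P K) 0 => lieSU (Fin 2)) (⟨p.src.shift p.ν, p.μ⟩ : PBond (F.P K) 0) - ContinuousLinearMap.proj (R := ℝ) (φ := fun _ : PBond (F.P K) 0 => lieSU (Fin 2)) (⟨p.src, p.ν⟩ : PBond (F.P K) 0) : (PBond (F.P K) 0 → lieSU (Fin 2)) →L[ℝ] lieSU (Fin 2))
          : (PBond (F.P K) 0 → lieSU (Fin 2)) →L[ℝ] (PBond (F.P K) 0 → lieSU (Fin 2)) →L[ℝ] ℝ) (X' X) (X' X) := by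
  classical
  set Wm : MSField (F.P K) (SU 2) := avgFamily (avOfRecord F 2 K) (qsstarGIter0 k V) with hWmdef
  -- the fibre condition at `Y = 0`
  have hfib0 := hmin.self_of_nhds
  rw [map_zero, B16Sect1Backgrounds.expMul_zero, hX₀, expChart_zero] at hfib0
  have hU : AgreeOn (Bj M₁ Z k) (avgFamily (avOfRecord F 2 K) U₀) Wm := hfib0.2.1
  have hcons := hcons_of_plaqsInside_maxDomT h0 Z (Sset k) hΩk
  -- §1 of p611770: the rotations and the twisted slice vector
  obtain ⟨ρr, hρφ, hρn⟩ := exists_rotE3_of_lieSU2Coord hφ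
  obtain ⟨R, hRdef⟩ : ∃ R : PBond (F.P K) k → EuclideanSpace ℝ (Fin 3) →ₗ[ℝ] EuclideanSpace ℝ (Fin 3),
      ∀ b, R b = if ‖((Wm k b : SU 2) : Matrix (Fin 2) (Fin 2) ℂ) - 1‖ ≤ τ / 2 then ρr (Wm k b) else LinearMap.id := ⟨_, fun b => rfl⟩
  have hRn : ∀ b v, ‖R b v - v‖ ≤ τ * ‖v‖ := by
    intro b v
    by_cases hb : ‖((Wm k b : SU 2) : Matrix (Fin 2) (Fin 2) ℂ) - 1‖ ≤ τ / 2
    · have h1 : R b = ρr (Wm k b) := by rw [hRdef, if_pos hb]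
      rw [h1]
      calc ‖ρr (Wm k b) v - v‖ ≤ 2 * ‖((Wm k b : SU 2) : Matrix (Fin 2) (Fin 2) ℂ) - 1‖ * ‖v‖ := hρn _ _
        _ ≤ 2 * (τ / 2) * ‖v‖ := by gcongr
        _ = τ * ‖v‖ := by ring
    · have h1 : R b = LinearMap.id := by rw [hRdef, if_neg hb]
      rw [h1, LinearMap.id_apply, sub_self, norm_zero]
      positivity
  obtain ⟨Xt, hXt⟩ := exists_twistSlice X R
  have hclose : ∀ b, ‖ιA S T Xt b - ιA S T X b‖ ≤ τ * ‖ιA S T X b‖ := twistSlice_close hXt hRn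
  -- (β3): the top components of the curved datum velocity are the twisted coordinates
  have hΨ' : DifferentiableAt ℝ (msChart F 2 K k (Bj M₁ Z k) Wm U₀) (Xf 0) := by rw [hX₀]; exact hΨ
  have hy : ∀ (b : PBond (F.P K) k) (hb : b ∈ bondsOf (Bj M₁ Z k k)), ‖((Wm k b : SU 2) : Matrix (Fin 2) (Fin 2) ℂ) - 1‖ ≤ τ / 2 →
      fderiv ℝ (msChart F 2 K k (Bj M₁ Z k) Wm U₀) 0 (X' X) (constrEnum (Bj M₁ Z k) k ⟨Fin.last k, ⟨b, hb⟩⟩) = φ (ιA S T Xt b) := by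
    intro b hb hwb
    have h := fderiv_msChart_comp_apply_top_of_isMinimizer_family S T hk hφ (Bj M₁ Z k) reg V U₀ hmin hX hΨ' X b hb
    rw [hX₀] at h
    rw [h, hXt b, ← hρφ]
    congr 1
    show ρr (Wm k b) (ιA S T X b) = R b (ιA S T X b)
    rw [hRdef, if_pos hwb]
  -- the chain `Y_i := ψ ∘ Q♭_i(↑w′)`
  obtain ⟨ψ, hψv, hψZ⟩ := exists_su2ReCoord
  set Y : (i : ℕ) → VecField (F.P K) i (EuclideanSpace ℝ (Fin 3)) := fun i b => ψ (Q i (fun c => (((X' X) c : lieSU (Fin 2)) : Matrix (Fin 2) (Fin 2) ℂ)) b) with hY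
  have hL : ((F.P K).L : ℝ) ≠ 0 := by exact_mod_cast (F.P K).L_pos.ne'
  have hchain : ∀ (ν : Fin (F.P K).d), (⟨0, h0⟩ : Fin (F.P K).d) ≠ ν → ∀ i, i < k → ∀ y ∈ Sset (i + 1),
      oc (Y (i + 1)) ⟨0, h0⟩ ν y = ((F.P K).L : ℝ) • oc (bondAvg (Y i)) ⟨0, h0⟩ ν y :=
    fun ν _ i _ y _ => chainLaw_iterLin_comp_linearMap Q hQs ψ (fun c => (((X' X) c : lieSU (Fin 2)) : Matrix (Fin 2) (Fin 2) ℂ)) i ⟨0, h0⟩ ν y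
  have hψφ : ∀ v : EuclideanSpace ℝ (Fin 3), ψ (((φ v : lieSU (Fin 2)) : Matrix (Fin 2) (Fin 2) ℂ)) = v := fun v => by rw [hφ, hψv]
  have hw' : ∀ b, φ (Y 0 b) = (X' X) b := fun b => by
    rw [hY]
    simp only [hQ0]
    exact lieSU2Coord_reCoord_eq hφ hψZ ((X' X) b)
  -- the top member on the region's constrained bonds: `Y_k(b) = ιA X̃(b) − D(b)` with `D(b) = ψ(↑E_b)`, `‖D(b)‖² ≤ (C·δ_W·p(w′))²∕2`
  obtain ⟨D, hDdef⟩ : ∃ D : VecField (F.P K) k (EuclideanSpace ℝ (Fin 3)), ∀ b, D b = ιA S T Xt b - Y k b := ⟨_, fun b => rfl⟩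
  have hYD : ∀ b, Y k b = ιA S T Xt b - D b := fun b => by rw [hDdef, sub_sub_cancel]
  have hDb : ∀ (b : PBond (F.P K) k) (hb : b ∈ bondsOf (Bj M₁ Z k k)), ‖((Wm k b : SU 2) : Matrix (Fin 2) (Fin 2) ℂ) - 1‖ ≤ τ / 2 →
      (∀ b₀ ∈ feeds k b, ‖((U₀ b₀ : SU 2) : Matrix (Fin 2) (Fin 2) ℂ) - 1‖ ≤ δW) → ‖D b‖ ^ 2 ≤ (C * δW * p (X' X)) ^ 2 / 2 := by
    intro b hb hwb hloc
    have hsy : (constrEnum (Bj M₁ Z k) k).symm (constrEnum (Bj M₁ Z k) k ⟨Fin.last k, ⟨b, hb⟩⟩) = ⟨Fin.last k, ⟨b, hb⟩⟩ := Equiv.symm_apply_apply _ _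
    have hE : ‖fderiv ℝ (msChart F 2 K k (Bj M₁ Z k) Wm U₀) 0 (X' X) (constrEnum (Bj M₁ Z k) k ⟨Fin.last k, ⟨b, hb⟩⟩)
        - fderiv ℝ (msChart F 2 K k (Bj M₁ Z k) (avgFamily (avOfRecord F 2 K) (1 : GaugeField (F.P K) 0 (SU 2))) (1 : GaugeField (F.P K) 0 (SU 2))) 0 (X' X) (constrEnum (Bj M₁ Z k) k ⟨Fin.last k, ⟨b, hb⟩⟩)‖ ≤ C * δW * p (X' X) :=
      hδ2 (Bj M₁ Z k) Wm U₀ (fun _ hj => B14.Eq213DetSet.Bj_of_gt hj) hk hU hΨ (constrEnum (Bj M₁ Z k) k ⟨Fin.last k, ⟨b, hb⟩⟩) hδW0 hδWρ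
        (fun b₀ hb₀ => hloc b₀ (by rw [hsy] at hb₀; exact hb₀)) (X' X)
    have hflat : Q k (fun c => (((X' X) c : lieSU (Fin 2)) : Matrix (Fin 2) (Fin 2) ℂ)) b
        = ((fderiv ℝ (msChart F 2 K k (Bj M₁ Z k) (avgFamily (avOfRecord F 2 K) (1 : GaugeField (F.P K) 0 (SU 2))) (1 : GaugeField (F.P K) 0 (SU 2))) 0 (X' X) (constrEnum (Bj M₁ Z k) k ⟨Fin.last k, ⟨b, hb⟩⟩) : lieSU (Fin 2)) : Matrix (Fin 2) (Fin 2) ℂ) :=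
      iterLin_eq_of_fderiv_msChart_one_eq Q hQ0 hQs (Bj M₁ Z k) (X' X) rfl b hb
    have hDeq : D b = ψ (((fderiv ℝ (msChart F 2 K k (Bj M₁ Z k) Wm U₀) 0 (X' X) (constrEnum (Bj M₁ Z k) k ⟨Fin.last k, ⟨b, hb⟩⟩)
        - fderiv ℝ (msChart F 2 K k (Bj M₁ Z k) (avgFamily (avOfRecord F 2 K) (1 : GaugeField (F.P K) 0 (SU 2))) (1 : GaugeField (F.P K) 0 (SU 2))) 0 (X' X) (constrEnum (Bj M₁ Z k) k ⟨Fin.last k, ⟨b, hb⟩⟩) : lieSU (Fin 2)) : Matrix (Fin 2) (Fin 2) ℂ)) := by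
      rw [hDdef]
      show ιA S T Xt b - ψ (Q k (fun c => (((X' X) c : lieSU (Fin 2)) : Matrix (Fin 2) (Fin 2) ℂ)) b) = _
      rw [hflat, ← hψφ (ιA S T Xt b), ← hy b hb hwb, Submodule.coe_sub, map_sub]
    have hnZ : ∀ Zb : lieSU (Fin 2), ‖ψ ((Zb : lieSU (Fin 2)) : Matrix (Fin 2) (Fin 2) ℂ)‖ ^ 2 = ‖Zb‖ ^ 2 / 2 := fun Zb => by
      have h2 := norm_sq_lieSU2Coord hφ (ψ ((Zb : lieSU (Fin 2)) : Matrix (Fin 2) (Fin 2) ℂ))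
      rw [lieSU2Coord_reCoord_eq hφ hψZ Zb] at h2
      linarith
    rw [hDeq, hnZ]
    have hE2 := pow_le_pow_left₀ (norm_nonneg _) hE 2
    linarith
  -- per axial plaquette of the region: `‖oc D‖² ≤ 8·(C·δ_W·p(w′))²`
  have hocD : ∀ (ν : Fin (F.P K).d), ∀ y ∈ Sset k, ‖oc D ⟨0, h0⟩ ν y‖ ^ 2 ≤ 8 * (C * δW * p (X' X)) ^ 2 := by
    intro ν y hy'
    obtain ⟨h1, h2, h3, h4⟩ := hcons ν y hy'
    obtain ⟨t1, t2, t3, t4⟩ := hW' ν y hy'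
    have d1 := hDb _ h1 t1 fun b₀ hb₀ => hδW ν y hy' b₀ (Or.inl hb₀)
    have d2 := hDb _ h2 t2 fun b₀ hb₀ => hδW ν y hy' b₀ (Or.inr (Or.inl hb₀))
    have d3 := hDb _ h3 t3 fun b₀ hb₀ => hδW ν y hy' b₀ (Or.inr (Or.inr (Or.inl hb₀)))
    have d4 := hDb _ h4 t4 fun b₀ hb₀ => hδW ν y hy' b₀ (Or.inr (Or.inr (Or.inr hb₀)))
    have hn : ‖oc D ⟨0, h0⟩ ν y‖ ≤ ‖D ⟨y, ⟨0, h0⟩⟩‖ + ‖D ⟨y.shift ⟨0, h0⟩, ν⟩‖ + ‖D ⟨y.shift ν, ⟨0, h0⟩⟩‖ + ‖D ⟨y, ν⟩‖ := by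
      simp only [oc]
      exact (norm_sub_le _ _).trans (add_le_add ((norm_sub_le _ _).trans (add_le_add (norm_add_le _ _) le_rfl)) le_rfl)
    have hsq : ‖oc D ⟨0, h0⟩ ν y‖ ^ 2 ≤ (‖D ⟨y, ⟨0, h0⟩⟩‖ + ‖D ⟨y.shift ⟨0, h0⟩, ν⟩‖ + ‖D ⟨y.shift ν, ⟨0, h0⟩⟩‖ + ‖D ⟨y, ν⟩‖) ^ 2 :=
      pow_le_pow_left₀ (norm_nonneg _) hn 2
    nlinarith [sq_nonneg (‖D ⟨y, ⟨0, h0⟩⟩‖ - ‖D ⟨y.shift ⟨0, h0⟩, ν⟩‖), sq_nonneg (‖D ⟨y, ⟨0, h0⟩⟩‖ - ‖D ⟨y.shift ν, ⟨0, h0⟩⟩‖),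
      sq_nonneg (‖D ⟨y, ⟨0, h0⟩⟩‖ - ‖D ⟨y, ν⟩‖), sq_nonneg (‖D ⟨y.shift ⟨0, h0⟩, ν⟩‖ - ‖D ⟨y.shift ν, ⟨0, h0⟩⟩‖),
      sq_nonneg (‖D ⟨y.shift ⟨0, h0⟩, ν⟩‖ - ‖D ⟨y, ν⟩‖), sq_nonneg (‖D ⟨y.shift ν, ⟨0, h0⟩⟩‖ - ‖D ⟨y, ν⟩‖)]
  -- sums over the axial planes of the region
  set Fν : Finset (Fin (F.P K).d) := Finset.univ.filter (fun ν : Fin (F.P K).d => (⟨0, h0⟩ : Fin (F.P K).d) ≠ ν) with hFν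
  have hsumD : ∑ ν ∈ Fν, ∑ y ∈ Sset k, ‖oc D ⟨0, h0⟩ ν y‖ ^ 2 ≤ 8 * ((F.P K).d : ℝ) * ((Sset k).card : ℝ) * (C * δW * p (X' X)) ^ 2 := by
    calc ∑ ν ∈ Fν, ∑ y ∈ Sset k, ‖oc D ⟨0, h0⟩ ν y‖ ^ 2
        ≤ ∑ ν ∈ Fν, ∑ y ∈ Sset k, 8 * (C * δW * p (X' X)) ^ 2 := Finset.sum_le_sum fun ν _ => Finset.sum_le_sum fun y hy' => hocD ν y hy'
      _ ≤ ∑ ν : Fin (F.P K).d, ∑ y ∈ Sset k, 8 * (C * δW * p (X' X)) ^ 2 :=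
          Finset.sum_le_sum_of_subset_of_nonneg (Finset.filter_subset _ _) fun ν _ _ => Finset.sum_nonneg fun y _ => by positivity
      _ = 8 * ((F.P K).d : ℝ) * ((Sset k).card : ℝ) * (C * δW * p (X' X)) ^ 2 := by
          simp only [Finset.sum_const, Finset.card_univ, Fintype.card_fin, nsmul_eq_mul]
          ring
  -- the twisted circulation is dominated by the region sum (g0's Step 1)
  have hcirc : (∑ z ∈ box m lo, ∑ μ : Fin (F.P K).d, ∑ a : Fin 3, curl (fun b => ιA S T Xt (⟨castSite b.1, b.2⟩ : PBond (F.P K) k) a) z ⟨0, h0⟩ μ ^ 2)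
      ≤ ∑ ν ∈ Fν, ∑ y ∈ Sset k, ‖oc (ιA S T Xt) ⟨0, h0⟩ ν y‖ ^ 2 := by
    rw [circ_eq_sum_normSq_oc h0 Xt (box m lo), Finset.sum_comm]
    have hplane : ∀ ν : Fin (F.P K).d, ∑ z ∈ box m lo, ‖oc (ιA S T Xt) ⟨0, h0⟩ ν (castSite z)‖ ^ 2 ≤ ∑ y ∈ Sset k, ‖oc (ιA S T Xt) ⟨0, h0⟩ ν y‖ ^ 2 :=
      fun ν => sum_box_castSite_le_sum_of_subset lo hm (Sset k) hwin (fun y => ‖oc (ιA S T Xt) ⟨0, h0⟩ ν y‖ ^ 2) fun y => by positivity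
    have hdiag : ∑ y ∈ Sset k, ‖oc (ιA S T Xt) ⟨0, h0⟩ ⟨0, h0⟩ y‖ ^ 2 = 0 :=
      Finset.sum_eq_zero fun y _ => by rw [oc_self_eq_zero, norm_zero]; simp
    calc ∑ ν : Fin (F.P K).d, ∑ z ∈ box m lo, ‖oc (ιA S T Xt) ⟨0, h0⟩ ν (castSite z)‖ ^ 2
        ≤ ∑ ν : Fin (F.P K).d, ∑ y ∈ Sset k, ‖oc (ιA S T Xt) ⟨0, h0⟩ ν y‖ ^ 2 := Finset.sum_le_sum fun ν _ => hplane ν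
      _ = ∑ ν ∈ Fν, ∑ y ∈ Sset k, ‖oc (ιA S T Xt) ⟨0, h0⟩ ν y‖ ^ 2 := by
          rw [← Finset.sum_filter_add_sum_filter_not Finset.univ (fun ν : Fin (F.P K).d => (⟨0, h0⟩ : Fin (F.P K).d) ≠ ν)]
          have hrest : ∑ ν ∈ Finset.univ.filter (fun ν : Fin (F.P K).d => ¬ (⟨0, h0⟩ : Fin (F.P K).d) ≠ ν),
              ∑ y ∈ Sset k, ‖oc (ιA S T Xt) ⟨0, h0⟩ ν y‖ ^ 2 = 0 :=
            Finset.sum_eq_zero fun ν hν => by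
              have : ν = ⟨0, h0⟩ := (not_not.mp (Finset.mem_filter.mp hν).2).symm
              rw [this, hdiag]
          rw [hrest, add_zero]
  -- the pointwise splitting `‖a − e‖² ≥ (1−η)‖a‖² − (η⁻¹−1)‖e‖²`, summed
  have hsplit : (1 - η) * (∑ ν ∈ Fν, ∑ y ∈ Sset k, ‖oc (ιA S T Xt) ⟨0, h0⟩ ν y‖ ^ 2)
      - (η⁻¹ - 1) * (∑ ν ∈ Fν, ∑ y ∈ Sset k, ‖oc D ⟨0, h0⟩ ν y‖ ^ 2)
      ≤ ∑ ν ∈ Fν, ∑ y ∈ Sset k, ‖oc (Y k) ⟨0, h0⟩ ν y‖ ^ 2 := by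
    rw [Finset.mul_sum, Finset.mul_sum, ← Finset.sum_sub_distrib]
    refine Finset.sum_le_sum fun ν _ => ?_
    rw [Finset.mul_sum, Finset.mul_sum, ← Finset.sum_sub_distrib]
    refine Finset.sum_le_sum fun y _ => ?_
    have hoc : oc (Y k) ⟨0, h0⟩ ν y = oc (ιA S T Xt) ⟨0, h0⟩ ν y - oc D ⟨0, h0⟩ ν y := by
      simp only [oc, hYD]
      abel
    rw [hoc]
    exact norm_sub_sq_ge' _ _ hη0 hη1
  -- (T): the twist
  have htwist := circ_twist_ge_sub h0 X Xt hτ hclose lo hm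
  -- the weighted chain (v1.1 of g0's file) with `ζ := 𝟙_{S_0}`, against the window form
  have hBW : ((Fintype.card (Fin 2) : ℝ)⁻¹ • ∑ p ∈ W, (innerSL ℝ (E := lieSU (Fin 2))).bilinearComp
        (ContinuousLinearMap.proj (R := ℝ) (φ := fun _ : PBond (F.P K) 0 => lieSU (Fin 2)) (⟨p.src, p.μ⟩ : PBond (F.P K) 0) + ContinuousLinearMap.proj (R := ℝ) (φ := fun _ : PBond (F.P K) 0 => lieSU (Fin 2)) (⟨p.src.shift p.μ, p.ν⟩ : PBond (F.P K) 0)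
          - ContinuousLinearMap.proj (R := ℝ) (φ := fun _ : PBond (F.P K) 0 => lieSU (Fin 2)) (⟨p.src.shift p.ν, p.μ⟩ : PBond (F.P K) 0) - ContinuousLinearMap.proj (R := ℝ) (φ := fun _ : PBond (F.P K) 0 => lieSU (Fin 2)) (⟨p.src, p.ν⟩ : PBond (F.P K) 0) : (PBond (F.P K) 0 → lieSU (Fin 2)) →L[ℝ] lieSU (Fin 2))
        (ContinuousLinearMap.proj (R := ℝ) (φ := fun _ : PBond (F.P K) 0 => lieSU (Fin 2)) (⟨p.src, p.μ⟩ : PBond (F.P K) 0) + ContinuousLinearMap.proj (R := ℝ) (φ := fun _ : PBond (F.P K) 0 => lieSU (Fin 2)) (⟨p.src.shift p.μ, p.ν⟩ : PBond (F.P K) 0)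
          - ContinuousLinearMap.proj (R := ℝ) (φ := fun _ : PBond (F.P K) 0 => lieSU (Fin 2)) (⟨p.src.shift p.ν, p.μ⟩ : PBond (F.P K) 0) - ContinuousLinearMap.proj (R := ℝ) (φ := fun _ : PBond (F.P K) 0 => lieSU (Fin 2)) (⟨p.src, p.ν⟩ : PBond (F.P K) 0) : (PBond (F.P K) 0 → lieSU (Fin 2)) →L[ℝ] lieSU (Fin 2))
        : (PBond (F.P K) 0 → lieSU (Fin 2)) →L[ℝ] (PBond (F.P K) 0 → lieSU (Fin 2)) →L[ℝ] ℝ) (X' X) (X' X)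
      = ∑ p ∈ W, ‖oc (Y 0) p.μ p.ν p.src‖ ^ 2 := by
    rw [flatFormOn_apply_self]
    have hcomb : ∀ p : Plaq (F.P K) 0,
        ‖(X' X) ⟨p.src, p.μ⟩ + (X' X) ⟨p.src.shift p.μ, p.ν⟩ - (X' X) ⟨p.src.shift p.ν, p.μ⟩ - (X' X) ⟨p.src, p.ν⟩‖ ^ 2 = 2 * ‖oc (Y 0) p.μ p.ν p.src‖ ^ 2 := fun p => by
      rw [← hw', ← hw', ← hw', ← hw', ← map_add, ← map_sub, ← map_sub, norm_sq_lieSU2Coord hφ]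
      rfl
    simp only [hcomb, ← Finset.mul_sum, Fintype.card_fin, Nat.cast_ofNat]
    ring
  have hchainW : (((F.P K).L : ℝ) ^ (F.P K).d) ^ k / ((((F.P K).L : ℝ)) ^ 2 * ((F.P K).L : ℝ) ^ 2) ^ k * ∑ ν ∈ Fν, ∑ y ∈ Sset k, ‖oc (Y k) ⟨0, h0⟩ ν y‖ ^ 2
      ≤ ((Fintype.card (Fin 2) : ℝ)⁻¹ • ∑ p ∈ W, (innerSL ℝ (E := lieSU (Fin 2))).bilinearComp
          (ContinuousLinearMap.proj (R := ℝ) (φ := fun _ : PBond (F.P K) 0 => lieSU (Fin 2)) (⟨p.src, p.μ⟩ : PBond (F.P K) 0) + ContinuousLinearMap.proj (R := ℝ) (φ := fun _ : PBond (F.P K) 0 => lieSU (Fin 2)) (⟨p.src.shift p.μ, p.ν⟩ : PBond (F.P K) 0)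
            - ContinuousLinearMap.proj (R := ℝ) (φ := fun _ : PBond (F.P K) 0 => lieSU (Fin 2)) (⟨p.src.shift p.ν, p.μ⟩ : PBond (F.P K) 0) - ContinuousLinearMap.proj (R := ℝ) (φ := fun _ : PBond (F.P K) 0 => lieSU (Fin 2)) (⟨p.src, p.ν⟩ : PBond (F.P K) 0) : (PBond (F.P K) 0 → lieSU (Fin 2)) →L[ℝ] lieSU (Fin 2))
          (ContinuousLinearMap.proj (R := ℝ) (φ := fun _ : PBond (F.P K) 0 => lieSU (Fin 2)) (⟨p.src, p.μ⟩ : PBond (F.P K) 0) + ContinuousLinearMap.proj (R := ℝ) (φ := fun _ : PBond (F.P K) 0 => lieSU (Fin 2)) (⟨p.src.shift p.μ, p.ν⟩ : PBond (F.P K) 0)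
            - ContinuousLinearMap.proj (R := ℝ) (φ := fun _ : PBond (F.P K) 0 => lieSU (Fin 2)) (⟨p.src.shift p.ν, p.μ⟩ : PBond (F.P K) 0) - ContinuousLinearMap.proj (R := ℝ) (φ := fun _ : PBond (F.P K) 0 => lieSU (Fin 2)) (⟨p.src, p.ν⟩ : PBond (F.P K) 0) : (PBond (F.P K) 0 → lieSU (Fin 2)) →L[ℝ] lieSU (Fin 2))
          : (PBond (F.P K) 0 → lieSU (Fin 2)) →L[ℝ] (PBond (F.P K) 0 → lieSU (Fin 2)) →L[ℝ] ℝ) (X' X) (X' X) := by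
    have h := B16Ineq17FlatRouteConstants.sum_normSq_oc_top_le_weighted_of_flat_chain h0 hk hL Y Sset hS hchain
      (fun x : Site (F.P K) 0 => if x ∈ Sset 0 then (1 : ℝ) else 0) (fun x => by positivity) (fun x hx => by simp [hx])
    refine h.trans ?_
    rw [hBW]
    have hsub : Finset.univ.filter (fun q : Plaq (F.P K) 0 => q.src ∈ Sset 0) ⊆ W := fun q hq => hWin q (Finset.mem_filter.mp hq).2
    calc ∑ q : Plaq (F.P K) 0, (fun x : Site (F.P K) 0 => if x ∈ Sset 0 then (1 : ℝ) else 0) q.src * ‖oc (Y 0) q.μ q.ν q.src‖ ^ 2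
        = ∑ q ∈ Finset.univ.filter (fun q : Plaq (F.P K) 0 => q.src ∈ Sset 0), ‖oc (Y 0) q.μ q.ν q.src‖ ^ 2 := by
          rw [Finset.sum_filter]
          refine Finset.sum_congr rfl fun q _ => ?_
          show (if q.src ∈ Sset 0 then (1 : ℝ) else 0) * _ = _
          by_cases hq : q.src ∈ Sset 0
          · rw [if_pos hq, if_pos hq, one_mul]
          · rw [if_neg hq, if_neg hq, zero_mul]
      _ ≤ ∑ p ∈ W, ‖oc (Y 0) p.μ p.ν p.src‖ ^ 2 := Finset.sum_le_sum_of_subset_of_nonneg hsub fun p _ _ => sq_nonneg _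
  -- assembly
  have hratio : 0 ≤ (((F.P K).L : ℝ) ^ (F.P K).d) ^ k / ((((F.P K).L : ℝ)) ^ 2 * ((F.P K).L : ℝ) ^ 2) ^ k := by positivity
  have h1η : 0 ≤ 1 - η := by linarith
  have hηi : 0 ≤ η⁻¹ - 1 := by
    have : 1 ≤ η⁻¹ := one_le_inv_iff₀.mpr ⟨hη0, hη1.le⟩
    linarith
  have hinner : (1 - η) * ((∑ z ∈ box m lo, ∑ μ : Fin (F.P K).d, ∑ a : Fin 3, curl (fun b => ιA S T X (⟨castSite b.1, b.2⟩ : PBond (F.P K) k) a) z ⟨0, h0⟩ μ ^ 2)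
        - 16 * (((F.P K).d : ℝ) + 1) * τ * ‖X‖ ^ 2)
      - (η⁻¹ - 1) * (8 * ((F.P K).d : ℝ) * ((Sset k).card : ℝ) * (C * δW * p (X' X)) ^ 2)
      ≤ ∑ ν ∈ Fν, ∑ y ∈ Sset k, ‖oc (Y k) ⟨0, h0⟩ ν y‖ ^ 2 := by
    have a1 := mul_le_mul_of_nonneg_left (htwist.trans hcirc) h1η
    have a2 := mul_le_mul_of_nonneg_left hsumD hηi
    linarith
  exact (mul_le_mul_of_nonneg_left hinner hratio).trans hchainW

/-- ★★ **THE SAME WITH THE (δ₂)-COMPONENT CONSTANTS SUPPLIED** (this seat's `exists_delta2_letter_component`): ONE `C ≥ 0`, `ρ > 0` per height. [cite: Balaban1989LargeFieldII, (1.7) pp.357–358, (1.12)–(1.13) p.359] -/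
theorem exists_hmX_federbush_window_of_isMinimizer_family (h0 : 0 < (F.P K).d) (hk : k ≤ (F.P K).m + (F.P K).K)
    (Q : (i : ℕ) → (PBond (F.P K) 0 → Matrix (Fin 2) (Fin 2) ℂ) → PBond (F.P K) i → Matrix (Fin 2) (Fin 2) ℂ)
    (hQ0 : ∀ Y, Q 0 Y = Y) (hQs : ∀ (i : ℕ) (Y : PBond (F.P K) 0 → Matrix (Fin 2) (Fin 2) ℂ) (c : PBond (F.P K) (i + 1)), Q (i + 1) Y c = linAvg (Q i Y) c)
    (p : Seminorm ℝ (PBond (F.P K) 0 → lieSU (Fin 2)))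
    (hp : ∀ Y : PBond (F.P K) 0 → lieSU (Fin 2), ∑ b, ‖(Y b : Matrix (Fin 2) (Fin 2) ℂ)‖ ^ 2 ≤ p Y ^ 2) :
    ∃ C ρ : ℝ, 0 ≤ C ∧ 0 < ρ ∧
      ∀ (Z : Set (Site (F.P K) 0)) {S : Set (Site (F.P K) k)} {T : Finset (PBond (F.P K) k)} (X : GaugeSlice S T (EuclideanSpace ℝ (Fin 3)))
    {m : Fin (F.P K).d → ℕ} (lo : Fin (F.P K).d → ℤ) (hm : ∀ κ, (m κ : ℤ) ≤ (F.P K).sitesPerDir k)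
    (Sset : (i : ℕ) → Finset (Site (F.P K) i)) (hwin : ∀ z ∈ box m lo, (castSite z : Site (F.P K) k) ∈ Sset k)
    (hS : ∀ (ν : Fin (F.P K).d), (⟨0, h0⟩ : Fin (F.P K).d) ≠ ν → ∀ i, i < k → ∀ y ∈ Sset (i + 1), ∀ (r : Fin (F.P K).d → Fin (F.P K).L) (s t : ℕ),
      s < (F.P K).L → t < (F.P K).L → runSite (runSite (Site.blockSite y r) ⟨0, h0⟩ s) ν t ∈ Sset i)
    {φ : EuclideanSpace ℝ (Fin 3) →ₗ[ℝ] lieSU (Fin 2)} (hφ : ∀ v, ((φ v : lieSU (Fin 2)) : Matrix (Fin 2) (Fin 2) ℂ) = quatMatrix (imQuat v))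
    (hΩk : ∀ (ν : Fin (F.P K).d), ∀ s ∈ Sset k, s ∈ pts k (maxDomT M₁ Z k) ∧ s.shift ⟨0, h0⟩ ∈ pts k (maxDomT M₁ Z k) ∧ s.shift ν ∈ pts k (maxDomT M₁ Z k))
    (reg : Set (GaugeField (F.P K) 0 (SU 2))) (V : GaugeField (F.P K) k (SU 2)) (U₀ : GaugeField (F.P K) 0 (SU 2))
    {Xf : GaugeSlice S T (EuclideanSpace ℝ (Fin 3)) → PBond (F.P K) 0 → lieSU (Fin 2)} (hX₀ : Xf 0 = 0)
    (hmin : ∀ᶠ Y in 𝓝 (0 : GaugeSlice S T (EuclideanSpace ℝ (Fin 3))),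
      IsMinimizer (avOfRecord F 2 K) reg (Bj M₁ Z k) (avgFamily (avOfRecord F 2 K) (qsstarGIter0 k (expMul su2Chart (ιA S T Y) V))) (expChart U₀ (Xf Y)))
    {X' : GaugeSlice S T (EuclideanSpace ℝ (Fin 3)) →L[ℝ] PBond (F.P K) 0 → lieSU (Fin 2)} (hX : HasFDerivAt Xf X' 0)
    (hΨ : DifferentiableAt ℝ (msChart F 2 K k (Bj M₁ Z k) (avgFamily (avOfRecord F 2 K) (qsstarGIter0 k V)) U₀) 0)
    {τ : ℝ} (hτ : 0 < τ)
    (hW' : ∀ (ν : Fin (F.P K).d), ∀ s ∈ Sset k,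
      ‖((avgFamily (avOfRecord F 2 K) (qsstarGIter0 k V) k ⟨s, ⟨0, h0⟩⟩ : SU 2) : Matrix (Fin 2) (Fin 2) ℂ) - 1‖ ≤ τ / 2 ∧
      ‖((avgFamily (avOfRecord F 2 K) (qsstarGIter0 k V) k ⟨s.shift ⟨0, h0⟩, ν⟩ : SU 2) : Matrix (Fin 2) (Fin 2) ℂ) - 1‖ ≤ τ / 2 ∧
      ‖((avgFamily (avOfRecord F 2 K) (qsstarGIter0 k V) k ⟨s.shift ν, ⟨0, h0⟩⟩ : SU 2) : Matrix (Fin 2) (Fin 2) ℂ) - 1‖ ≤ τ / 2 ∧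
      ‖((avgFamily (avOfRecord F 2 K) (qsstarGIter0 k V) k ⟨s, ν⟩ : SU 2) : Matrix (Fin 2) (Fin 2) ℂ) - 1‖ ≤ τ / 2)
        (W : Finset (Plaq (F.P K) 0)) (hWin : ∀ q : Plaq (F.P K) 0, q.src ∈ Sset 0 → q ∈ W)
        ⦃δW : ℝ⦄ (hδW0 : 0 ≤ δW) (hδWρ : δW < ρ)
        (hδW : ∀ (ν : Fin (F.P K).d), ∀ s ∈ Sset k, ∀ b₀ : PBond (F.P K) 0,
          (b₀ ∈ feeds k (⟨s, ⟨0, h0⟩⟩ : PBond (F.P K) k) ∨ b₀ ∈ feeds k (⟨s.shift ⟨0, h0⟩, ν⟩ : PBond (F.P K) k)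
            ∨ b₀ ∈ feeds k (⟨s.shift ν, ⟨0, h0⟩⟩ : PBond (F.P K) k) ∨ b₀ ∈ feeds k (⟨s, ν⟩ : PBond (F.P K) k)) →
          ‖((U₀ b₀ : SU 2) : Matrix (Fin 2) (Fin 2) ℂ) - 1‖ ≤ δW)
        ⦃η : ℝ⦄ (hη0 : 0 < η) (hη1 : η < 1),
        (((F.P K).L : ℝ) ^ (F.P K).d) ^ k / ((((F.P K).L : ℝ)) ^ 2 * ((F.P K).L : ℝ) ^ 2) ^ k *
            ((1 - η) * ((∑ z ∈ box m lo, ∑ μ : Fin (F.P K).d, ∑ a : Fin 3, curl (fun b => ιA S T X (⟨castSite b.1, b.2⟩ : PBond (F.P K) k) a) z ⟨0, h0⟩ μ ^ 2)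
                - 16 * (((F.P K).d : ℝ) + 1) * τ * ‖X‖ ^ 2)
              - (η⁻¹ - 1) * (8 * ((F.P K).d : ℝ) * ((Sset k).card : ℝ) * (C * δW * p (X' X)) ^ 2))
          ≤ ((Fintype.card (Fin 2) : ℝ)⁻¹ • ∑ p ∈ W, (innerSL ℝ (E := lieSU (Fin 2))).bilinearComp
              (ContinuousLinearMap.proj (R := ℝ) (φ := fun _ : PBond (F.P K) 0 => lieSU (Fin 2)) (⟨p.src, p.μ⟩ : PBond (F.P K) 0) + ContinuousLinearMap.proj (R := ℝ) (φ := fun _ : PBond (F.P K) 0 => lieSU (Fin 2)) (⟨p.src.shift p.μ, p.ν⟩ : PBond (F.P K) 0)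
                - ContinuousLinearMap.proj (R := ℝ) (φ := fun _ : PBond (F.P K) 0 => lieSU (Fin 2)) (⟨p.src.shift p.ν, p.μ⟩ : PBond (F.P K) 0) - ContinuousLinearMap.proj (R := ℝ) (φ := fun _ : PBond (F.P K) 0 => lieSU (Fin 2)) (⟨p.src, p.ν⟩ : PBond (F.P K) 0) : (PBond (F.P K) 0 → lieSU (Fin 2)) →L[ℝ] lieSU (Fin 2))
              (ContinuousLinearMap.proj (R := ℝ) (φ := fun _ : PBond (F.P K) 0 => lieSU (Fin 2)) (⟨p.src, p.μ⟩ : PBond (F.P K) 0) + ContinuousLinearMap.proj (R := ℝ) (φ := fun _ : PBond (F.P K) 0 => lieSU (Fin 2)) (⟨p.src.shift p.μ, p.ν⟩ : PBond (F.P K) 0)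
                - ContinuousLinearMap.proj (R := ℝ) (φ := fun _ : PBond (F.P K) 0 => lieSU (Fin 2)) (⟨p.src.shift p.ν, p.μ⟩ : PBond (F.P K) 0) - ContinuousLinearMap.proj (R := ℝ) (φ := fun _ : PBond (F.P K) 0 => lieSU (Fin 2)) (⟨p.src, p.ν⟩ : PBond (F.P K) 0) : (PBond (F.P K) 0 → lieSU (Fin 2)) →L[ℝ] lieSU (Fin 2))
              : (PBond (F.P K) 0 → lieSU (Fin 2)) →L[ℝ] (PBond (F.P K) 0 → lieSU (Fin 2)) →L[ℝ] ℝ) (X' X) (X' X) := by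
  obtain ⟨C, ρ, hC, hρ, hδ2⟩ := exists_delta2_letter_component (F := F) (N := 2) (K := K) k Q hQ0 hQs p hp
  exact ⟨C, ρ, hC, hρ, fun Z S T X m lo hm Sset hwin hS φ hφ hΩk reg V U₀ Xf hX₀ hmin X' hX hΨ τ hτ hW' W hWin δW hδW0 hδWρ hδW η hη0 hη1 =>
    hmX_federbush_window_of_delta2Component h0 hk Q hQ0 hQs p hδ2 Z X lo hm Sset hwin hS hφ hΩk reg V U₀ hX₀ hmin hX hΨ hτ hW' W hWin hδW0 hδWρ hδW hη0 hη1⟩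

end Velocity

end Summit.QuantumFields.YangMills.BalabanUVNodes.N12NearFlatFederbushVelocityWindow

end
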